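import Mathlib
import Summits.CriticalPhenomena.CardyFormulaZ2.Theses.CardyPickBootstrap
import HarnessLib

/-!
# Line `loewner-kernel` — skeleton v1 for crux `PickLimit` (stmt-CriticalPhenomena-8390)

    PickLimit := every pointwise sublimit `p` (along a mesh sequence `δ_k → 0⁺`) of the bond-ℤ² crossing
    probabilities of a sliding family `η ↦ Q η` has differentiated Nevanlinna data on `(0,1)`:
    `p′(s) = β + ∫ (t−s)⁻² dμ(t)`, `β ≥ 0`, `μ ≥ 0` carried by `ℝ ∖ (0,1)`, `∫(1+t²)⁻¹dμ < ∞`.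

Registered crux decl `Summit.CriticalPhenomena.CardyFormulaZ2.Theses.CardyPickBootstrap.PickLimit`
(route CardyPickBootstrap, rank 2). Filed by the redirect strategist
(unit cstrat-stmt-CriticalPhenomena-8390-r1, 2026-08-17) as the TYPED TRANSFER of the crux into
Rosenblum–Rovnyak's derivative-free form of Loewner's theorem (Hardy Classes and Operator Theory, 1985,
§2.12 Theorem A, book p. 36): a bounded real measurable `f₀` on `Δ` is a.e. the trace of a Pick function
iff the truncated Loewner-kernel quadratic forms `∬_{|s−t|>ε} [f₀(s)−f₀(t)]/(s−t) φ(s) φ̄(t) ds dt` have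
nonnegative limit as `ε ↓ 0` for all test functions `φ`. That criterion (i) needs no derivative, (ii) makes
sense for the finite-mesh crossing-probability STEP functions `η ↦ P_δ(η)`, (iii) passes to bounded
pointwise limits at fixed `ε` by dominated convergence. Hence the cut:

    PickLimit ⇐ [S1 finite-mesh kernel positivity (percolation; the bet)]
              + [S2 finite mesh ⇒ sublimit kernel positivity (dominated convergence + η-monotonicity ⇒ measurability)]
              + [S3 Loewner bridge, Theorem-A form (classical analysis: R–R §2.12 Thm A/B, App. §6 Thm B–C)]
              + [S4 a-priori shape of sublimits (route support item `APrioriShape`, stmt-CriticalPhenomena-8394, by name)]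

`PickLimit_of` below is the kernel-checked composition; the sorries are exactly the four `stub_*`.
The only OPEN percolation content is S1, a reflection-positivity-type inequality for a quadratic form in
finite-mesh crossing probabilities over moduli space — a statement in which no scaling (sub)limit occurs.
S3 is a published theorem (to be formalised or carried as named facts `loewner_theorem`,
`nevanlinna_representation` + Stieltjes inversion); S2, S4 are M-sized.
-/

namespace Summit.CriticalPhenomena.CardyFormulaZ2.Cruxes.PickLimit.LoewnerKernel

open Summit.CriticalPhenomena.CardyFormulaZ2.Theses.CardyPickBootstrap
open Literature.Probability.RandomPlanarGeometry Literature.Probability.Percolation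
open MeasureTheory Filter Set

/-! ## Vocabulary (definitionally the route's inlined blocks; `pickLimit_iff`) -/

/-- The route's inlined SLIDING-FAMILY hypothesis, verbatim: same Jordan domain and marks 0,1,2 for
all `η, η' ∈ (0,1)`, and every uniformizing datum of `Q η` has cross-ratio `η`. -/
def IsSlidingFamily (Q : ℝ → ConformalRectangle) : Prop :=
  (∀ η ∈ Set.Ioo (0:ℝ) 1, ∀ η' ∈ Set.Ioo (0:ℝ) 1,
      (Q η).toJordanDomain = (Q η').toJordanDomain ∧ (Q η).mark 0 = (Q η').mark 0 ∧
        (Q η).mark 1 = (Q η').mark 1 ∧ (Q η).mark 2 = (Q η').mark 2) ∧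
    (∀ η ∈ Set.Ioo (0:ℝ) 1,
      ∀ (φ : ConformalEquiv UpperHalfPlane.upperHalfPlaneSet (Q η).carrier) (x : Fin 4 → ℝ),
        (Q η).IsUniformizing φ x → crossRatio x = η)

/-- `p` is the pointwise limit on `(0,1)` of the bond-ℤ² crossing probabilities of `Q` along the mesh
sequence `δs → 0⁺` (the route's inlined SUBLIMIT hypothesis, verbatim). -/
def IsSublimit (Q : ℝ → ConformalRectangle) (δs : ℕ → ℝ) (p : ℝ → ℝ) : Prop :=
  (∀ k : ℕ, 0 < δs k) ∧ Tendsto δs atTop (nhds 0) ∧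
    ∀ η ∈ Set.Ioo (0:ℝ) 1,
      Tendsto (fun k : ℕ => bondDomainCrossingProb (Q η) (δs k)) atTop (nhds (p η))

/-- The conclusion of `PickLimit` for one function `p` (verbatim). -/
def HasPickData (p : ℝ → ℝ) : Prop :=
  ∃ (β : ℝ) (μ : Measure ℝ), (0 ≤ β ∧ μ (Set.Ioo (0:ℝ) 1) = 0 ∧
    Integrable (fun t : ℝ => (1 + t ^ 2)⁻¹) μ ∧
      ∀ s ∈ Set.Ioo (0:ℝ) 1, HasDerivAt p (β + ∫ t, ((t - s) ^ 2)⁻¹ ∂μ) s)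

/-- `PickLimit` is, definitionally, "every sublimit of every sliding family has Pick data". -/
theorem pickLimit_iff :
    PickLimit ↔ ∀ Q, IsSlidingFamily Q → ∀ δs p, IsSublimit Q δs p → HasPickData p := by
  unfold PickLimit IsSlidingFamily IsSublimit HasPickData
  constructor
  · rintro h Q hQ δs p ⟨hpos, hδ, hp⟩
    exact h Q hQ δs hpos hδ p hp
  · intro h Q hQ δs hpos hδ p hp
    exact h Q hQ δs p ⟨hpos, hδ, hp⟩

/-- Truncated Loewner-kernel quadratic form on `(0,1)`:
`∬_{(0,1)², |s−t|>ε} [f(s)−f(t)]/(s−t) φ(s) conj(φ(t)) ds dt` (Rosenblum–Rovnyak (2-36), `Δ = (0,1)`). -/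
noncomputable def truncLoewnerForm (f : ℝ → ℝ) (φ : ℝ → ℂ) (ε : ℝ) : ℂ :=
  ∫ s in Set.Ioo (0:ℝ) 1, ∫ t in Set.Ioo (0:ℝ) 1,
    (if ε < |s - t| then (((f s - f t) / (s - t) : ℝ) : ℂ) * φ s * (starRingEnd ℂ) (φ t) else 0)

/-- Rosenblum–Rovnyak Theorem-A positivity of `f` on `(0,1)` against continuous test functions
compactly supported in `(0,1)`: `liminf_{ε↓0} Re (truncated form) ≥ 0`, spelled out `∀ η > 0 ∃ ε₀ …`. -/
def PickKernelPositive (f : ℝ → ℝ) : Prop :=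
  ∀ φ : ℝ → ℂ, Continuous φ → tsupport φ ⊆ Set.Ioo (0:ℝ) 1 → HasCompactSupport φ →
    ∀ η : ℝ, 0 < η → ∃ ε₀ : ℝ, 0 < ε₀ ∧ ∀ ε ∈ Set.Ioo (0:ℝ) ε₀, -η ≤ (truncLoewnerForm f φ ε).re

/-- TRANSFER FORM of the crux: every sublimit of every sliding family is Loewner-kernel positive. -/
def KernelPositiveLimit : Prop :=
  ∀ Q, IsSlidingFamily Q → ∀ δs p, IsSublimit Q δs p → PickKernelPositive p

/-! ## Stub signatures -/

/-- S1 signature — FINITE-MESH KERNEL POSITIVITY (the percolation bet; no sublimit occurs): for a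
sliding family, a mesh sequence `δ_k → 0⁺`, a test function `φ` and `η > 0` there is `ε₀ > 0` such that
for every `ε ∈ (0, ε₀)` the truncated Loewner-kernel form of the finite-mesh function
`s ↦ P_{1/2}[(Q s) crossed at mesh δ_k]` has real part `≥ −η` for all large `k`. -/
def Sig.FiniteMeshKernelPositivity : Prop :=
  ∀ Q, IsSlidingFamily Q → ∀ (δs : ℕ → ℝ), (∀ k : ℕ, 0 < δs k) → Tendsto δs atTop (nhds 0) →
    ∀ φ : ℝ → ℂ, Continuous φ → tsupport φ ⊆ Set.Ioo (0:ℝ) 1 → HasCompactSupport φ →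
      ∀ η : ℝ, 0 < η → ∃ ε₀ : ℝ, 0 < ε₀ ∧ ∀ ε ∈ Set.Ioo (0:ℝ) ε₀, ∃ k₀ : ℕ, ∀ k ≥ k₀,
        -η ≤ (truncLoewnerForm (fun s => bondDomainCrossingProb (Q s) (δs k)) φ ε).re

/-- S2 signature — FINITE MESH ⇒ SUBLIMIT (glue with content): finite-mesh kernel positivity passes to
every pointwise sublimit. Proof plan: for fixed `ε > 0` the integrand is bounded by `‖φ‖²_∞/ε` on the
bounded square, the finite-mesh functions are monotone in `η` (the discrete arc of `(cd)` grows with the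
sliding mark, that of `(ab)` is fixed) hence measurable, and dominated convergence gives
`truncLoewnerForm P_{δ_k} φ ε → truncLoewnerForm p φ ε`. -/
def Sig.KernelLimitOfFiniteMesh : Prop :=
  Sig.FiniteMeshKernelPositivity → KernelPositiveLimit

/-- S3 signature — LOEWNER BRIDGE, Theorem-A form (classical analysis): a monotone `[0,1]`-valued
Loewner-kernel-positive function on `(0,1)` has differentiated Nevanlinna data with `μ((0,1)) = 0`.
Rosenblum–Rovnyak 1985 §2.12 Thm A (a.e. equal to a Pick trace; monotone + continuous ⇒ everywhere),
Thm B / Loewner 1934 (continuation across `(0,1)`), App. §6 Thm B (Nevanlinna) and Thm C (Stieltjes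
inversion), then differentiation under the integral. TRUE in print; not in Mathlib (named facts
`Literature.Analysis.Complex.loewner_theorem`, `nevanlinna_representation` cover two of the four steps). -/
def Sig.LoewnerBridgeA : Prop :=
  ∀ p : ℝ → ℝ, (∀ s ∈ Set.Ioo (0:ℝ) 1, p s ∈ Set.Icc (0:ℝ) 1) → MonotoneOn p (Set.Ioo (0:ℝ) 1) →
    PickKernelPositive p → HasPickData p

/-! ## Stubs (the ONLY sorries of this file) -/

/-- S1 — finite-mesh Loewner-kernel positivity of bond-ℤ² crossing probabilities in the modulus
(OPEN; the load-bearing percolation stub; lattice evidence: the card's exact transfer-matrix census,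
strips of width ≤ 8, 0/90,997 order-2 violations, Loewner 3×3/4×4 PSD, `(P_m)` exactly Pick for m ≤ 6). -/
theorem stub_finiteMeshKernelPositivity : Sig.FiniteMeshKernelPositivity := by
  sorry

/-- S2 — dominated-convergence / measurability glue from finite mesh to sublimits (M). -/
theorem stub_kernelLimitOfFiniteMesh : Sig.KernelLimitOfFiniteMesh := by
  sorry

/-- S3 — the Loewner bridge in Rosenblum–Rovnyak Theorem-A form (classical, L–XL to formalise). -/
theorem stub_loewnerBridgeA : Sig.LoewnerBridgeA := by
  sorry

/-- S4 — a-priori shape of sublimits: the route's support item `APrioriShape`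
(stmt-CriticalPhenomena-8394), BY NAME (only its monotonicity clause is consumed here). -/
theorem stub_aPrioriShape : APrioriShape := by
  sorry

/-! ## Proved glue and the composition -/

/-- Sublimits of crossing probabilities take values in `[0,1]` on `(0,1)`. -/
theorem sublimit_mem_Icc {Q : ℝ → ConformalRectangle} {δs : ℕ → ℝ} {p : ℝ → ℝ}
    (h : IsSublimit Q δs p) : ∀ s ∈ Set.Ioo (0:ℝ) 1, p s ∈ Set.Icc (0:ℝ) 1 := by
  intro s hs
  obtain ⟨-, -, hp⟩ := h
  exact isClosed_Icc.mem_of_tendsto (hp s hs)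
    (Filter.Eventually.of_forall fun k => bondDomainCrossingProb_mem_Icc _ _)

/-- Sublimits of a sliding family are monotone on `(0,1)` (from `APrioriShape`). -/
theorem sublimit_monotoneOn (hS4 : APrioriShape) {Q : ℝ → ConformalRectangle} (hQ : IsSlidingFamily Q)
    {δs : ℕ → ℝ} {p : ℝ → ℝ} (h : IsSublimit Q δs p) : MonotoneOn p (Set.Ioo (0:ℝ) 1) := by
  obtain ⟨hpos, hδ, hp⟩ := h
  exact (hS4 Q hQ δs hpos hδ p hp).2.1

/-- COMPOSITION (kernel-checked, no sorry of its own): the four stubs imply the crux BY NAME. -/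
theorem PickLimit_of (hS1 : Sig.FiniteMeshKernelPositivity) (hS2 : Sig.KernelLimitOfFiniteMesh)
    (hS3 : Sig.LoewnerBridgeA) (hS4 : APrioriShape) : PickLimit := by
  rw [pickLimit_iff]
  intro Q hQ δs p hsub
  exact hS3 p (sublimit_mem_Icc hsub) (sublimit_monotoneOn hS4 hQ hsub) (hS2 hS1 Q hQ δs p hsub)

/-- The crux from the registered stubs (sanity instance of the composition). -/
theorem PickLimit_of_stubs : PickLimit :=
  PickLimit_of stub_finiteMeshKernelPositivity stub_kernelLimitOfFiniteMesh stub_loewnerBridgeA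
    stub_aPrioriShape

end Summit.CriticalPhenomena.CardyFormulaZ2.Cruxes.PickLimit.LoewnerKernel
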